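import Literature.NumberTheory.EllipticCurves.HasseWeilAbelianEulerFactorHoldsProofs
import HarnessLib

/-!
# The Euler factors of the Tate modules of an elliptic curve over a number field are rational:
# the corrected named fact `hasRationalEulerFactors_geomPoints_of_isElliptic` is a theorem

`Proofs` file (theorems only; no definitions, no named facts) for
`Literature.NumberTheory.EllipticCurves.HasseWeilAbelianRationalEulerFactors`, discharging its
single named fact `WeierstrassCurve.hasRationalEulerFactors_geomPoints_of_isElliptic`: for an
elliptic curve `E/K` over a number field (`W` with `[W.IsElliptic]`, `M = E(K̄) = W.geomPoints`)
the family of Mathlib local polynomials `v ↦ L_v(E, T) = W.localPolynomialAt v ∈ ℤ[T] ⊆ ℚ[T]` is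
a family of rational Euler factors of `M` with empty exceptional set
(`Literature.NumberTheory.EllipticCurves.HasRationalEulerFactors`), i.e. for **every** prime `ℓ`,
every finite place `v ∤ ℓ` and all continuity / finiteness witnesses of `V_ℓ E`,
`det(1 - σ_v T ∣ (V_ℓ E)_{I_v}) = L_v(E, T)` in `ℚ_ℓ[T]` — Serre's strict compatibility of the
system `(V_ℓ E)_ℓ` with the factors `1 - a_v T + Nv T²`, `1 - c_v T` (`c_v = ±1`), `1` of Serre,
*Facteurs locaux* (1970), §2.4 (16), (17), c) (Œuvres II no. 87, PDF p. 556), whose integrality and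
`ℓ`-independence at the places of (potential) good reduction is Serre–Tate (1968), §2 Thm. 3
("The characteristic polynomial of `ρ_ℓ(σ)` has integral coefficients independent of `ℓ`", Œuvres II
no. 79, PDF p. 454), proved there from §1 Lemma 2 (the `D(v̄)`-equivariant reduction isomorphism
`A_m^I ≅ Ã_m`, PDF p. 450) and Weil.

## Proof (assembly of theorems already in the tree)

By the per-`ℓ` form `WeierstrassCurve.hasRationalEulerFactors_geomPoints_of_isElliptic_iff_forall`
(`HasseWeilAbelianEulerFactorElliptic`; pure bookkeeping, `ℤ[T] → ℚ[T] → ℚ_ℓ[T] = ℤ[T] → ℚ_ℓ[T]`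
and the exceptional set is empty) the fact is the conjunction over all primes `ℓ` of the corrected
per-`ℓ` facts `hasseWeilEulerFactor_geomPoints_of_isElliptic W ℓ`, and each of these is
the theorem `WeierstrassCurve.hasseWeilEulerFactor_geomPoints_of_isElliptic_holds W ℓ` of
`HasseWeilAbelianEulerFactorHoldsProofs` — assembled there, place by place exactly as in Serre
(1970) §2.4 (a)/(b)/(c) = Silverman, *AEC*, §C.16, from the good-reduction Euler factors
(`hasseWeilEulerFactor_of_hasGoodReduction_holds`: Néron–Ogg–Shafarevich + the reduction
isomorphism `T_ℓ E ≅ T_ℓ Ẽ`, Serre–Tate §1 Lemma 2, and `det(1 - φ T ∣ T_ℓ Ẽ) = 1 - a T + q T²`,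
Silverman V.2.3.1), the codimension of the inertia invariants at the multiplicative and additive
places (Silverman, *ATAEC*, Thm. IV.10.2(a); Kodaira–Néron over `K_v^nr`), and the two Frobenius
torsion facts at the multiplicative places (Serre–Tate §1 Lemmas 1–2 with the split / non-split
torus).  So this file only takes the conjunction over `ℓ`.

## Why a sibling `Proofs` file

The fact's own file `HasseWeilAbelianRationalEulerFactors` is imported by
`HasseWeilAbelianEulerFactorElliptic`, which is (transitively) imported by
`HasseWeilAbelianEulerFactorHoldsProofs`, where the per-`ℓ` discharge lives; appending the
discharge to the fact's file would close an import cycle, so it is landed here (D-0014 append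
protocol, sibling `<File>Proofs.lean`).

## Contents (all proved)

* `WeierstrassCurve.hasRationalEulerFactors_geomPoints_of_isElliptic_holds` — **the discharge**;
* `WeierstrassCurve.hasRationalEulerFactors_geomPoints_holds_of_isElliptic` — the schema instance
  `hasRationalEulerFactors_geomPoints W` (`HasseWeilAbelian`) for elliptic `W` (the all-`W` schema
  itself is false, `not_hasRationalEulerFactors_geomPoints_singularModel`, so only this pointwise
  form is asserted);
* `WeierstrassCurve.exists_hasseWeilEulerFactor_eq_map_of_isElliptic` — **`ℓ`-independence,
  unconditionally**: for elliptic `W`, primes `ℓ, ℓ'` and `v ∤ ℓ ℓ'`, the `ℓ`-adic and `ℓ'`-adic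
  Euler factors at `v` are the images of one polynomial in `ℤ[T]` (Serre–Tate Thm. 3, "integral
  coefficients independent of `ℓ`"), i.e. `hasseWeilEulerFactor_eq_of_hasRationalEulerFactors_geomPoints`
  with its hypothesis discharged.

## References

* J.-P. Serre, J. Tate, *Good reduction of abelian varieties*, Ann. of Math. 88 (1968), 492–517
  (= Œuvres II, no. 79), §1 Lemma 2 (PDF p. 450), §2 Thm. 3 and Corollary (PDF p. 454).
  [SerreTate1968]
* J.-P. Serre, *Facteurs locaux des fonctions zêta des variétés algébriques (définitions et
  conjectures)*, Sém. Delange–Pisot–Poitou 1969/70, exp. 19 (= Œuvres II, no. 87), §2.4 (16), (17),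
  c) (PDF p. 556). [Serre1970]
* J. H. Silverman, *The Arithmetic of Elliptic Curves*, 2nd ed. (2009), Thm. V.2.3.1,
  Thm. VII.7.1, §C.16 (PDF p. 390). [SilvermanAEC2009]

## Design

No definitions; theorems only; `noncomputable section`, `open scoped Classical NumberField`,
one universe `u` (`K : Type u`), deliberate dot-notation extensions of Mathlib's
`WeierstrassCurve` namespace exactly as in the fact's file; no instances, no `sorry`.  (No line
of this module docstring begins with a Lean command keyword: the harness's line-based fact
census tracks `namespace … end` textually, and a prose line opening with that keyword had
hidden the discharge below from it.)
-/

noncomputable section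

open scoped Classical NumberField Polynomial

open Field IsDedekindDomain Polynomial

universe u

namespace WeierstrassCurve

open Literature.NumberTheory.EllipticCurves Literature.NumberTheory.GaloisRepresentations

variable {K : Type u} [Field K] [NumberField K] (W : WeierstrassCurve K)

/-- **Discharge of `hasRationalEulerFactors_geomPoints_of_isElliptic`.**  For an elliptic curve
`E/K` over a number field, `v ↦ L_v(E, T) ∈ ℤ[T] ⊆ ℚ[T]` (Mathlib's local polynomial of a minimal
model at `v`: `1 - a_v T + q_v T²`, `1 - T`, `1 + T`, `1` by reduction type) is a family of rational
Euler factors of `E(K̄)` with empty exceptional set: for every prime `ℓ`, every finite place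
`v ∤ ℓ` and all continuity / finiteness witnesses, `det(1 - σ_v T ∣ (V_ℓ E)_{I_v}) = L_v(E, T)` in
`ℚ_ℓ[T]` (Serre (1970), §2.4 (16), (17), c); Serre–Tate (1968), §2 Thm. 3: the characteristic
polynomial of `ρ_ℓ(σ)` has integral coefficients independent of `ℓ`).  Proof: the conjunction over
all primes `ℓ` (`hasRationalEulerFactors_geomPoints_of_isElliptic_iff_forall`) of the per-`ℓ`
theorems `hasseWeilEulerFactor_geomPoints_of_isElliptic_holds W ℓ`
(`HasseWeilAbelianEulerFactorHoldsProofs`).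
[cite: SerreTate1968, §1 Lemma 2 (Œuvres II PDF p. 450), §2 Thm. 3 (PDF p. 454)]
[cite: Serre1970, §2.4 (16), (17), c) (Œuvres II PDF p. 556)] -/
theorem hasRationalEulerFactors_geomPoints_of_isElliptic_holds :
    W.hasRationalEulerFactors_geomPoints_of_isElliptic :=
  W.hasRationalEulerFactors_geomPoints_of_isElliptic_iff_forall.2 fun ℓ _ ↦
    W.hasseWeilEulerFactor_geomPoints_of_isElliptic_holds ℓ

/-- **The schema instance `hasRationalEulerFactors_geomPoints W` for an elliptic `W`**
(`HasseWeilAbelian`; the all-`W` schema has no `[W.IsElliptic]` binder and fails on split nodal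
cubics, `not_hasRationalEulerFactors_geomPoints_singularModel`, so only this pointwise form is
asserted): the hypothesis `H` of `hasseWeilEulerFactor_eq_of_hasRationalEulerFactors_geomPoints` and
the form under which `Literature.NumberTheory.EllipticCurves.hasseWeilLFunction` of the local
polynomials is the Hasse–Weil `L`-function of `E`.  Serre (1970), §2.4; Serre–Tate (1968), Thm. 3.
[cite: SerreTate1968, §2 Thm. 3 (Œuvres II PDF p. 454)] -/
theorem hasRationalEulerFactors_geomPoints_holds_of_isElliptic [W.IsElliptic] :
    W.hasRationalEulerFactors_geomPoints :=
  (W.hasRationalEulerFactors_geomPoints_of_isElliptic_iff_of_isElliptic).1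
    W.hasRationalEulerFactors_geomPoints_of_isElliptic_holds

/-- **`ℓ`-independence of the Euler factors of an elliptic curve, unconditionally** (Serre–Tate
(1968), §2 Thm. 3: *the characteristic polynomial of `ρ_ℓ(σ)` has integral coefficients
independent of `ℓ`*; here at every finite place, through the inertia coinvariants, Serre (1970)
§2.4).  For an elliptic curve `E/K` over a number field, two primes `ℓ, ℓ'` and a finite place
`v ∤ ℓ ℓ'`, the `ℓ`-adic and the `ℓ'`-adic Hasse–Weil Euler factors of `E(K̄)` at `v` (for any
continuity / finiteness witnesses) are the images in `ℚ_ℓ[T]`, `ℚ_{ℓ'}[T]` of one and the same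
polynomial `P ∈ ℤ[T]` (namely `L_v(E, T) = W.localPolynomialAt v`):
`hasseWeilEulerFactor_eq_of_hasRationalEulerFactors_geomPoints` with its hypothesis discharged by
`hasRationalEulerFactors_geomPoints_holds_of_isElliptic`.
[cite: SerreTate1968, §2 Thm. 3 (Œuvres II PDF p. 454)] -/
theorem exists_hasseWeilEulerFactor_eq_map_of_isElliptic [W.IsElliptic] {ℓ ℓ' : ℕ} [Fact ℓ.Prime]
    [Fact ℓ'.Prime]
    (h : Continuous fun x : absoluteGaloisGroup K × RationalTateModule (geomPoints W) ℓ ↦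
      rationalTateRepresentation (absoluteGaloisGroup K) (geomPoints W) ℓ x.1 x.2)
    (h' : Continuous fun x : absoluteGaloisGroup K × RationalTateModule (geomPoints W) ℓ' ↦
      rationalTateRepresentation (absoluteGaloisGroup K) (geomPoints W) ℓ' x.1 x.2)
    [Module.Finite ℚ_[ℓ] (W.rationalTateModule ℓ)] [Module.Finite ℚ_[ℓ'] (W.rationalTateModule ℓ')]
    {v : HeightOneSpectrum (𝓞 K)} (hℓ : (ℓ : 𝓞 K) ∉ v.asIdeal) (hℓ' : (ℓ' : 𝓞 K) ∉ v.asIdeal) :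
    ∃ P : ℤ[X], hasseWeilEulerFactor (geomPoints W) ℓ h v = P.map (Int.castRingHom ℚ_[ℓ]) ∧
      hasseWeilEulerFactor (geomPoints W) ℓ' h' v = P.map (Int.castRingHom ℚ_[ℓ']) :=
  W.hasseWeilEulerFactor_eq_of_hasRationalEulerFactors_geomPoints
    W.hasRationalEulerFactors_geomPoints_holds_of_isElliptic h h' hℓ hℓ'

end WeierstrassCurve

end
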